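import Mathlib.GroupTheory.FreeGroup.Basic
import Mathlib.Data.Fin.VecNotation
import Literature.AlgebraicGeometry.HodgeTheory.LocallyTrivialExtensionClasses
import Summits.HodgeConjecture.HodgeConjecture.Theorems.LinearSystemTorelliLocalTubeSpanThinCocycle

/-!
# Route LinearSystemTorelli — crux `LocalTubeSpan`: the thin configuration of parameter `μ` — the undetected class

Helper file (`--supports stmt-HodgeConjecture-2490`, line `Sketch`, cycle 4 wave 3, stub
`stub_thinCocycleMu`).  The `μ`-parametric version of the cycle-3 thin boundary
`localTubeSpan_not_injective_evalCoinv_thin` (file `…ThinCocycle`, the case `μ = 4`): a NEGATIVE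
boundary result for the crux.  The crux's mechanism is *cyclic detection*, the injectivity of
Schnell's third map `evalCoinv A : H¹(G, A) → ∏_{g ∈ G} A/(g - 1)A`, `[φ] ↦ (φ g mod (g - 1)A)_g`
(`Literature.AlgebraicGeometry.HodgeTheory.LocallyTrivialExtensionClasses`), which C. Schnell,
*Primitive cohomology and the tube mapping*, Math. Z. 268 (2010) (= arXiv:0711.3927), §7 Prop. 12
proves for the monodromy group of a skew-symmetric VANISHING LATTICE acting through its
Picard–Lefschetz transvections.  The Picard–Lefschetz SHAPE of the generators alone does not
imply cyclic detection, for any non-zero value `μ` of the pairing.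

**The thin configuration of parameter `μ ≠ 0`.** `G = F₃ = ⟨x₀, x₁, x₂⟩` (free) acts on `ℚ²`
through the three symplectic transvections `T_i(v) = v - B(v, δ_i) δ_i` of the form
`B(x, y) = μ (x₀ y₁ - x₁ y₀)` along `δ₀ = (1, 0)`, `δ₁ = (0, 1)`, `δ₂ = (1, 1) = δ₀ + δ₁`:

  `T₀(v) = (v₀ + μ v₁, v₁)`, `T₁(v) = (v₀, v₁ - μ v₀)`, `T₂(v) = v - μ (v₀ - v₁) (1, 1)`.

Granted the dichotomy `hclass` for the elements of `ρ(F₃)` (every `g` either has `ρ(g) - 1`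
invertible or is conjugate to a power of a generator — the ping-pong / thin-group input for
`μ ≥ 4`, a separate stub of the line), the cocycle `φ` with `φ(x₀) = φ(x₁) = 0`, `φ(x₂) = (1, 1)`
is

* a cocycle (any generator values extend to a cocycle on a FREE group:
  `localTubeSpan_freeGroup_exists_cocycles₁` of file `…ThinCocycle`);
* undetected by every single element: if `ρ(g) - 1` is invertible then `(g - 1)ℚ² = ℚ²`; if
  `g = h x_i^n h⁻¹` then undetectedness is conjugation invariant
  (`localTubeSpan_cocycles₁_apply_conj_mem_subOneRange`) and passes from `x_i` to `⟨x_i⟩`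
  (`localTubeSpan_cocycles₁_apply_mem_subOneRange_of_mem_closure_singleton`), while
  `φ(x₀) = φ(x₁) = 0` and `φ(x₂) = (1, 1) = T₂(y) - y` for `y = (0, 1/μ)` (here `μ ≠ 0` is used:
  for `μ = 0` the images `(T_i - 1)ℚ² = ℚ δ_i` collapse to `0`);
* not a coboundary: `ρ(g) x - x = φ(g)` at `g = x₀, x₁` reads `μ x₁ = 0 = μ x₀`, so `x = 0` as
  `μ ≠ 0`, contradicting the value `(1, 1)` at `x₂`.

Hence `evalCoinv` kills the non-zero class `[φ]`:
`localTubeSpan_not_injective_evalCoinv_thinMu` (the registered stub).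

References: [Schnell2010] C. Schnell, Primitive cohomology and the tube mapping, Math. Z. 268
(2010), §3 (the third map), §7 (Prop. 12 and the Example of a non-injective restriction map).
-/

-- `Summit.HodgeConjecture.HodgeConjecture.Theorems` is the mandated namespace (single-conjunct
-- summit: Sub = Summit), which `linter.dupNamespace` flags on every declaration; the lakefile turns
-- the linter off tree-wide (weak option), restated here so stand-alone elaboration is warning-free.
set_option linter.dupNamespace false

noncomputable section

open CategoryTheory groupCohomology
open Literature.AlgebraicGeometry.HodgeTheory

namespace Summit.HodgeConjecture.HodgeConjecture.Theorems

/-! ### The thin configuration of parameter `μ`: an undetected non-zero class -/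

/-- **The thin configuration of parameter `μ ≠ 0` defeats cyclic detection** (registered stub
`stub_thinCocycleMu`).  Let `F₃ = ⟨x₀, x₁, x₂⟩` act on `ℚ²` through the symplectic transvections
`T₀(v) = (v₀ + μv₁, v₁)`, `T₁(v) = (v₀, v₁ - μv₀)`, `T₂(v) = v - μ(v₀ - v₁)(1, 1)` (the
Picard–Lefschetz transvections of `B(x, y) = μ(x₀y₁ - x₁y₀)` along `(1,0), (0,1), (1,1)`), and
assume the dichotomy `hclass`: for every `g`, either `ρ(g) - 1` is invertible or `g` is conjugate
to a power of a generator.  Then Schnell's third map `H¹(F₃, ℚ²) → ∏_g ℚ²/(g - 1)ℚ²` is NOT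
injective: the cocycle with `φ(x₀) = φ(x₁) = 0`, `φ(x₂) = (1, 1)` is undetected by every
element (`(1, 1) = T₂(y) - y` for `y = (0, 1/μ)`; invertible `ρ(g) - 1` detect nothing;
conjugates and powers by `localTubeSpan_cocycles₁_apply_conj_mem_subOneRange` and
`localTubeSpan_cocycles₁_apply_mem_subOneRange_of_mem_closure_singleton`) but is not a
coboundary (`ρ(g)x - x = φ(g)` at `x₀, x₁` gives `μx₁ = 0 = μx₀`, so `x = 0` as `μ ≠ 0`).
The case `μ = 4` is `localTubeSpan_not_injective_evalCoinv_thin`.  Contrast [Schnell2010] §7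
Prop. 12, where the transvections come from a vanishing lattice and the third map is injective.
[folklore] -/
theorem localTubeSpan_not_injective_evalCoinv_thinMu (μ : ℚ) (hμ : μ ≠ 0)
    (ρ : Representation ℚ (FreeGroup (Fin 3)) (Fin 2 → ℚ))
    (hτ₀ : ∀ v, ρ (FreeGroup.of 0) v = ![v 0 + μ * v 1, v 1])
    (hτ₁ : ∀ v, ρ (FreeGroup.of 1) v = ![v 0, v 1 - μ * v 0])
    (hτ₂ : ∀ v, ρ (FreeGroup.of 2) v = ![v 0 - μ * (v 0 - v 1), v 1 - μ * (v 0 - v 1)])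
    (hclass : ∀ g : FreeGroup (Fin 3), IsUnit (ρ g - 1) ∨
      ∃ (h : FreeGroup (Fin 3)) (i : Fin 3) (n : ℤ), g = h * FreeGroup.of i ^ n * h⁻¹) :
    ¬ Function.Injective (evalCoinv (Rep.of ρ)) := by
  -- the cocycle `φ(x₀) = 0, φ(x₁) = 0, φ(x₂) = (1, 1)`
  obtain ⟨φ, hφ⟩ := localTubeSpan_freeGroup_exists_cocycles₁ ρ ![0, 0, ![1, 1]]
  have h0 : φ (FreeGroup.of 0) = (0 : Fin 2 → ℚ) := hφ 0
  have h1 : φ (FreeGroup.of 1) = (0 : Fin 2 → ℚ) := hφ 1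
  have h2 : φ (FreeGroup.of 2) = ![1, 1] := hφ 2
  refine localTubeSpan_not_injective_evalCoinv_of_undetected (Rep.of ρ) φ φ.2 ?_ fun g => ?_
  · -- `[φ] ≠ 0`: `ρ g x - x = φ g` at `x₀, x₁` forces `x = 0` (as `μ ≠ 0`), contradicting the
    -- value at `x₂`
    rw [mem_coboundaries₁_iff_exists]
    rintro ⟨x, hx⟩
    have e0 := congr_fun (hx (FreeGroup.of 0)) 0
    have e1 := congr_fun (hx (FreeGroup.of 1)) 1
    have e2 := congr_fun (hx (FreeGroup.of 2)) 0
    rw [h0] at e0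
    rw [h1] at e1
    rw [h2] at e2
    simp only [Pi.sub_apply, Pi.zero_apply, hτ₀, hτ₁, hτ₂, Matrix.cons_val_zero,
      Matrix.cons_val_one] at e0 e1 e2
    -- `e0 : x₀ + μ x₁ - x₀ = 0`, `e1 : x₁ - μ x₀ - x₁ = 0`, `e2 : x₀ - μ (x₀ - x₁) - x₀ = 1`
    have hx1 : x 1 = 0 :=
      (mul_eq_zero.1 (by linear_combination e0 : μ * x 1 = 0)).resolve_left hμ
    have hx0 : x 0 = 0 :=
      (mul_eq_zero.1 (by linear_combination -e1 : μ * x 0 = 0)).resolve_left hμ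
    have h01 : (0 : ℚ) = 1 := by linear_combination e2 + μ * hx0 - μ * hx1
    exact zero_ne_one h01
  · -- `φ` is undetected by every `g`, via the dichotomy `hclass`
    rcases hclass g with hu | ⟨h, i, n, rfl⟩
    · -- `ρ g - 1` invertible: `(g - 1)A = A`
      obtain ⟨y, hy⟩ := ((Module.End.isUnit_iff _).1 hu).2 (φ g)
      exact ⟨y, hy⟩
    · -- `g = h x_i ^ n h⁻¹`: reduce to `x_i ^ n` (conjugation), then to `x_i` (cyclic subgroup)
      refine localTubeSpan_cocycles₁_apply_conj_mem_subOneRange (Rep.of ρ) φ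
        (FreeGroup.of i ^ n) h ?_
      refine localTubeSpan_cocycles₁_apply_mem_subOneRange_of_mem_closure_singleton (Rep.of ρ)
        φ (FreeGroup.of i) ?_ (Subgroup.mem_closure_singleton.2 ⟨n, rfl⟩)
      fin_cases i
      · show φ (FreeGroup.of 0) ∈ subOneRange (Rep.of ρ) (FreeGroup.of 0)
        rw [h0]
        exact Submodule.zero_mem _
      · show φ (FreeGroup.of 1) ∈ subOneRange (Rep.of ρ) (FreeGroup.of 1)
        rw [h1]
        exact Submodule.zero_mem _
      · -- `T₂` moves `y = (0, 1/μ)` by `-μ (y₀ - y₁) (1, 1) = (1, 1)`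
        show φ (FreeGroup.of 2) ∈ subOneRange (Rep.of ρ) (FreeGroup.of 2)
        rw [h2]
        refine ⟨![0, 1 / μ], ?_⟩
        rw [LinearMap.sub_apply, LinearMap.id_apply, Rep.of_ρ, hτ₂]
        funext j
        fin_cases j <;> simp [hμ]

end Summit.HodgeConjecture.HodgeConjecture.Theorems

end
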